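import Mathlib
import Summits.KontsevichZagierPeriods.Zeta5Search.LaiBrickCoefficients
import Literature.NumberTheory.DiophantineApproximation.DilogHermitePadeArithmetic
import HarnessLib

/-!
HONEST FRAMING: systematic search; no irrationality claim unless certified.

# Lai's denominators `∏_j D_{M_j n}` for the box function — the `Φ̃`-free part of [Lai2024BallRivoal, Lemma 4.1 (i), (iii)]

This file continues `LaiBricks.lean` / `LaiBrickCoefficients.lean` (bricks, `divDeriv_laiG_eq`, `lai_pf_isInt`, `lai_pf_eq_zero`): it sums the
coefficient-level statements into the two DENOMINATOR statements the κ₃-ladder skeleton (`LaiBoxInputs.isInt`, staged)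
needs, WITHOUT the arithmetic saving `Φ̃` (which is the separate prime-by-prime statement `laiG_isDOrd`):

* `lai_pf_sum_isInt` — for `1 ≤ s ≤ J`: `D_{(M−2δ_min)n}^{J−s} · C_n Σ_{k} c_{s−1,k} ∈ ℤ`, i.e. Lai's
  `D^{J−s} ρ̃_{n,s} ∈ ℤ` for the zeta coefficients `ρ̃_{n,s} = Σ_k a_{n,s,k}` ([Lai2024BallRivoal, (4.11) summed]);
* `lai_pf_harm_isInt` — for SORTED `δ` (monotone): `(∏_j D_{max(M−2δ_min, M−δ_j)·n}) · C_n Σ_{o<J} Σ_k c_{o,k} H_k^{(o+1)} ∈ ℤ`,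
  i.e. `∏_j D_{M_j n} · ρ̃_{n,0} ∈ ℤ` with Lai's `M_j = max{M−2δ₁, M−δ_j}` ([Lai2024BallRivoal, Lemma 4.1 (iii)] without `Φ̃`):
  the order-`(o+1)` coefficients live on poles lying in `≥ o+1` blocks, which for sorted `δ` means inside block `o+1`
  (`lai_pf_mem_block`), where `D_{(M−δ_{o+1})n}^{o+1} H_k^{(o+1)} ∈ ℤ` (tree `BallRivoal.isInt_dpow_mul_harm`).

* PACKAGING in the shape of the skeleton's fields (`Φ = 1` version): `lai_pf_exists_all` (data for every `n`), `laiCoef`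
  (`s = 0 ↦ −Σ c_{o,k}H_k^{(o+1)}`, `1 ≤ s ≤ J ↦ Σ_k c_{s−1,k}`, else `0`), `laiCoef_hasSum` (= the skeleton's `hasSum`),
  `laiCoef_isInt` (`C_n ∏_j D_{M_j n} · laiCoef n s ∈ ℤ` = `isInt` with `Φ = 1`), `laiCoef_dvd3` (`… ∈ D_{(M−δ₂)n}^3 ℤ` for
  `s ≥ 3` = `dvd3` with `Φ = 1`, `c = M − δ₂`; Lai's `γ₁ = 3·443` when `δ₀ = δ₁ = δ₂ = δ_min`). The sequel `LaiSaving.lean`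
  upgrades `Φ = 1` to a genuine saving factor prime by prime (`laiG_isDOrd`, `laiBrickExp_eq_laiPhiDiv` of `LaiBricks.lean`;
  pattern `Literature/…/ZudilinLemma19.lean`); the successor supplies the rate fields (`families/indep/DECAY-L1.md`).

Everything is PROVED (0 sorries) for arbitrary parameters; nothing is a named fact; no rate or irrationality statement.
Kernel status: this text was checked on the farm as the tail of ONE file `LaiBricks ++ LaiBrickCoefficients ++ this file`
(`lean check --json` rc 0 / 0 errors / 0 warnings / 0 sorries); as a separate module it elaborates verbatim once
`Zeta5Search/LaiBrickCoefficients.lean` is in the tree (its only non-Mathlib import besides HarnessLib).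
References: [Lai2024BallRivoal] L. Lai, arXiv:2407.14236, §3 (3.6), §4 Lemma 4.1; [BallRivoal2001] K. Ball, T. Rivoal,
Invent. Math. 146 (2001), Lemme 5; [Zudilin2004] W. Zudilin, J. Théor. Nombres Bordeaux 16 (2004), §7.
-/

noncomputable section

open Finset Filter Literature.NumberTheory.Transcendental Literature.Analysis.Calculus
open scoped Nat

namespace Summit.KontsevichZagierPeriods.Zeta5Search

section Denominators

open Polynomial
open Literature.NumberTheory.Transcendental.BallRivoal (harm isInt_dpow_mul_harm)

/-- Off the window `[dmin·n, (M−dmin)·n]` (with `dmin ≤ δ_j` for all `j`) every coefficient vanishes. [this file] -/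
theorem lai_pf_eq_zero_off_window (J r M n : ℕ) (δ : Fin J → ℕ) (hδ : ∀ j, 2 * δ j ≤ M) (hM : 0 < M)
    {c : ℕ → ℕ → ℚ}
    (hc : ∀ t : ℚ, (∀ p : ℕ, p ≤ M * n → t + p + 1 ≠ 0) →
      BallRivoal.pfEval (M * n) J c t =
        ((laiPoly J r M n δ).comp (X + C 1)).eval t / BallRivoal.poch (t + 1) (M * n + 1) ^ J)
    (dmin : ℕ) (hmin : ∀ j, dmin ≤ δ j) {k : ℕ} (hkM : k ≤ M * n)
    (hk : k < dmin * n ∨ (M - dmin) * n < k) {o : ℕ} (ho : o < J) : c o k = 0 := by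
  refine lai_pf_eq_zero_of_lt J r M n δ hδ hM hc (fun j => ?_) hkM ho
  rcases hk with h | h
  · exact Or.inl (h.trans_le (Nat.mul_le_mul_right n (hmin j)))
  · exact Or.inr ((Nat.mul_le_mul_right n (Nat.sub_le_sub_left (hmin j) M)).trans_lt h)

/-- **`D_{(M−2δ_min)n}^{J−s} · ρ̃_{n,s}/1 ∈ ℤ`** — the summed form of [Lai2024BallRivoal, (4.11)]: for `1 ≤ s ≤ J`,
`D_{(M−2·dmin)n}^{J−s} · C_n · Σ_{k ≤ Mn} c_{s−1,k}` is an integer. [this file] -/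
theorem lai_pf_sum_isInt (J r M n : ℕ) (δ : Fin J → ℕ) (hδ : ∀ j, 2 * δ j ≤ M) (hM : 0 < M) {c : ℕ → ℕ → ℚ}
    (hc : ∀ t : ℚ, (∀ p : ℕ, p ≤ M * n → t + p + 1 ≠ 0) →
      BallRivoal.pfEval (M * n) J c t =
        ((laiPoly J r M n δ).comp (X + C 1)).eval t / BallRivoal.poch (t + 1) (M * n + 1) ^ J)
    (dmin : ℕ) (hmin : ∀ j, dmin ≤ δ j) (h2 : 2 * dmin < M) {s : ℕ} (hs : 1 ≤ s) (hsJ : s ≤ J) :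
    ∃ z : ℤ, ((Nat.lcmUpto ((M - 2 * dmin) * n) : ℕ) : ℚ) ^ (J - s) *
      (laiC J r M n δ * ∑ p ∈ range (M * n + 1), c (s - 1) p) = z := by
  rw [mul_sum, mul_sum]
  refine Literature.NumberTheory.DiophantineApproximation.DilogPade.isInt_sum _ _ fun p hp => ?_
  have hpM : p ≤ M * n := Nat.lt_succ_iff.1 (mem_range.1 hp)
  by_cases hw : dmin * n ≤ p ∧ p ≤ (M - dmin) * n
  · exact lai_pf_isInt J r M n δ hδ hc dmin hmin h2 hw.1 hw.2 hs hsJ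
  · refine ⟨0, ?_⟩
    rw [lai_pf_eq_zero_off_window J r M n δ hδ hM hc dmin hmin hpM (by omega) (by omega), mul_zero, mul_zero,
      Int.cast_zero]

/-- For SORTED `δ`, a pole `−k` carrying a non-zero coefficient of order `o+1` lies inside the `(o+1)`-st block:
`δ_{o} n ≤ k ≤ (M−δ_{o}) n` (0-indexed `o`). [Lai2024BallRivoal, §3 (3.3)–(3.5)] [this file] -/
theorem lai_pf_mem_block (J r M n : ℕ) (δ : Fin J → ℕ) (hδ : ∀ j, 2 * δ j ≤ M) (hM : 0 < M) (hmono : Monotone δ)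
    {c : ℕ → ℕ → ℚ}
    (hc : ∀ t : ℚ, (∀ p : ℕ, p ≤ M * n → t + p + 1 ≠ 0) →
      BallRivoal.pfEval (M * n) J c t =
        ((laiPoly J r M n δ).comp (X + C 1)).eval t / BallRivoal.poch (t + 1) (M * n + 1) ^ J)
    {k : ℕ} (hkM : k ≤ M * n) {o : ℕ} (ho : o < J) (hne : c o k ≠ 0) :
    δ ⟨o, ho⟩ * n ≤ k ∧ k ≤ (M - δ ⟨o, ho⟩) * n := by
  by_contra hnot
  apply hne
  refine lai_pf_eq_zero J r M n δ hδ hM hc hkM ho ?_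
  -- the blocks containing `k` form an initial segment of indices `< o`
  have hsub : (univ.filter fun j : Fin J => δ j * n ≤ k ∧ k ≤ (M - δ j) * n) ⊆
      univ.filter fun j : Fin J => (j : ℕ) < o := by
    intro j hj
    rw [mem_filter] at hj ⊢
    refine ⟨mem_univ _, ?_⟩
    by_contra hjo
    have hle : δ ⟨o, ho⟩ ≤ δ j := hmono (Fin.mk_le_of_le_val (not_lt.1 hjo))
    apply hnot
    exact ⟨(Nat.mul_le_mul_right n hle).trans hj.2.1,
      hj.2.2.trans (Nat.mul_le_mul_right n (Nat.sub_le_sub_left hle M))⟩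
  have hcard : (univ.filter fun j : Fin J => (j : ℕ) < o).card = o := by
    have : (univ.filter fun j : Fin J => (j : ℕ) < o) = Finset.Iio ⟨o, ho⟩ := by
      ext j; simp [Fin.lt_def]
    rw [this, Fin.card_Iio]
  have h1 := card_le_card hsub
  have h2 := laiOff_add_card J M n δ hδ k
  omega

/-- The divisibility behind Lai's `M_j = max{M−2δ_min, M−δ_j}` for sorted `δ`:
`D_{(M−δ_o)n}^{o+1} · D_{(M−2·dmin)n}^{J−(o+1)} ∣ ∏_j D_{M_j n}` (the first `o+1` blocks have `M_j ≥ M−δ_o`, the others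
`M_j ≥ M−2·dmin`). [this file] -/
theorem lai_blockDenom_dvd (J M n : ℕ) (δ : Fin J → ℕ) (hmono : Monotone δ) (dmin : ℕ) {o : ℕ} (ho : o < J) :
    Nat.lcmUpto ((M - δ ⟨o, ho⟩) * n) ^ (o + 1) * Nat.lcmUpto ((M - 2 * dmin) * n) ^ (J - (o + 1)) ∣
      ∏ j, Nat.lcmUpto (max (M - 2 * dmin) (M - δ j) * n) := by
  have hcard1 : (univ.filter fun j : Fin J => (j : ℕ) ≤ o).card = o + 1 := by
    have : (univ.filter fun j : Fin J => (j : ℕ) ≤ o) = Finset.Iic ⟨o, ho⟩ := by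
      ext j; simp [Fin.le_iff_val_le_val]
    rw [this, Fin.card_Iic]
  have hcard2 : (univ.filter fun j : Fin J => ¬ (j : ℕ) ≤ o).card = J - (o + 1) := by
    have h := card_filter_add_card_filter_not (s := (univ : Finset (Fin J))) (fun j : Fin J => (j : ℕ) ≤ o)
    rw [card_univ, Fintype.card_fin, hcard1] at h
    omega
  have e : (∏ j : Fin J, (if (j : ℕ) ≤ o then Nat.lcmUpto ((M - δ ⟨o, ho⟩) * n)
      else Nat.lcmUpto ((M - 2 * dmin) * n))) =
      Nat.lcmUpto ((M - δ ⟨o, ho⟩) * n) ^ (o + 1) * Nat.lcmUpto ((M - 2 * dmin) * n) ^ (J - (o + 1)) := by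
    rw [prod_ite, prod_const, prod_const, hcard1, hcard2]
  rw [← e]
  refine prod_dvd_prod_of_dvd _ _ fun j _ => ?_
  split_ifs with hj
  · have hle : δ j ≤ δ ⟨o, ho⟩ := hmono (Fin.le_iff_val_le_val.2 hj)
    exact lcmUpto_dvd_lcmUpto
      (Nat.mul_le_mul_right n ((Nat.sub_le_sub_left hle M).trans (le_max_right _ _)))
  · exact lcmUpto_dvd_lcmUpto (Nat.mul_le_mul_right n (le_max_left _ _))

/-- `D_{(M−2·dmin)n}^J ∣ ∏_j D_{M_j n}`. [this file] -/
theorem lai_pow_dvd_blockDenom (J M n : ℕ) (δ : Fin J → ℕ) (dmin : ℕ) :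
    Nat.lcmUpto ((M - 2 * dmin) * n) ^ J ∣ ∏ j, Nat.lcmUpto (max (M - 2 * dmin) (M - δ j) * n) := by
  have e : (∏ _j : Fin J, Nat.lcmUpto ((M - 2 * dmin) * n)) = Nat.lcmUpto ((M - 2 * dmin) * n) ^ J := by
    rw [prod_const, card_univ, Fintype.card_fin]
  rw [← e]
  exact prod_dvd_prod_of_dvd _ _ fun j _ => lcmUpto_dvd_lcmUpto (Nat.mul_le_mul_right n (le_max_left _ _))

/-- **`∏_j D_{M_j n} · ρ̃_{n,0} ∈ ℤ` without `Φ̃`** ([Lai2024BallRivoal, Lemma 4.1 (iii)], `M_j = max{M−2δ_min, M−δ_j}`):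
for sorted `δ`, `(∏_j D_{max(M−2·dmin, M−δ_j)·n}) · C_n · Σ_{o<J} Σ_{k≤Mn} c_{o,k} H_k^{(o+1)}` is an integer. [this file] -/
theorem lai_pf_harm_isInt (J r M n : ℕ) (δ : Fin J → ℕ) (hδ : ∀ j, 2 * δ j ≤ M) (hM : 0 < M) (hmono : Monotone δ)
    {c : ℕ → ℕ → ℚ}
    (hc : ∀ t : ℚ, (∀ p : ℕ, p ≤ M * n → t + p + 1 ≠ 0) →
      BallRivoal.pfEval (M * n) J c t =
        ((laiPoly J r M n δ).comp (X + C 1)).eval t / BallRivoal.poch (t + 1) (M * n + 1) ^ J)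
    (dmin : ℕ) (hmin : ∀ j, dmin ≤ δ j) (h2 : 2 * dmin < M) :
    ∃ z : ℤ, (∏ j, ((Nat.lcmUpto (max (M - 2 * dmin) (M - δ j) * n) : ℕ) : ℚ)) *
      (laiC J r M n δ * ∑ o ∈ range J, ∑ p ∈ range (M * n + 1), c o p * harm (o + 1) p) = z := by
  rw [mul_sum, mul_sum]
  refine Literature.NumberTheory.DiophantineApproximation.DilogPade.isInt_sum _ _ fun o ho' => ?_
  have ho : o < J := mem_range.1 ho'
  rw [mul_sum, mul_sum]
  refine Literature.NumberTheory.DiophantineApproximation.DilogPade.isInt_sum _ _ fun p hp => ?_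
  have hpM : p ≤ M * n := Nat.lt_succ_iff.1 (mem_range.1 hp)
  by_cases hz : c o p = 0
  · exact ⟨0, by rw [hz, zero_mul, mul_zero, mul_zero, Int.cast_zero]⟩
  -- the pole lies in block `o` (0-indexed), hence in the window
  have hblk := lai_pf_mem_block J r M n δ hδ hM hmono hc hpM ho hz
  have hlo : dmin * n ≤ p := (Nat.mul_le_mul_right n (hmin _)).trans hblk.1
  have hhi : p ≤ (M - dmin) * n := hblk.2.trans (Nat.mul_le_mul_right n (Nat.sub_le_sub_left (hmin _) M))
  -- the two integrality inputs
  obtain ⟨z₁, hz₁⟩ := lai_pf_isInt J r M n δ hδ hc dmin hmin h2 hlo hhi (s := o + 1) (by omega) (by omega)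
  rw [Nat.add_sub_cancel] at hz₁
  obtain ⟨z₂, hz₂⟩ := isInt_dpow_mul_harm ((M - δ ⟨o, ho⟩) * n) (Nat.lcmUpto ((M - δ ⟨o, ho⟩) * n))
    (fun l h1 h2 => Int.natCast_dvd_natCast.2 (dvd_lcmUpto h1 h2)) (o + 1) p hblk.2
  -- `D_{(M−δ_o)n}^{o+1} · D_{(M−2dmin)n}^{J−(o+1)}` divides `∏_j D_{M_j n}`
  obtain ⟨w, hw⟩ := lai_blockDenom_dvd J M n δ hmono dmin ho
  refine ⟨w * z₁ * z₂, ?_⟩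
  have hcast : (∏ j, ((Nat.lcmUpto (max (M - 2 * dmin) (M - δ j) * n) : ℕ) : ℚ)) =
      ((∏ j, Nat.lcmUpto (max (M - 2 * dmin) (M - δ j) * n) : ℕ) : ℚ) := by push_cast; rfl
  rw [hcast, hw]
  push_cast
  rw [← hz₁, ← hz₂]
  ring

/-! ## Packaging in the shape of the κ₃-ladder skeleton (`LaiBoxInputs`: `coef`, `hasSum`, `isInt`, `dvd3`) — `Φ = 1` version

With `N_n := C_n · ∏_j D_{M_j n}` (the skeleton's `normaliser C Dm Φ n` for `Φ = 1`, `Dm_j = max(M−2δ_min, M−δ_j)`) and the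
coefficients `laiCoef` below, the four arithmetic fields of `LaiBoxInputs` hold BY THE THEOREMS OF THIS FILE; what the successor
adds is the saving (`Φ = Φ̃_n` via `laiG_isDOrd`, prime by prime) and the three rate fields. -/

/-- Partial-fraction data for every `n` (a choice function; any data will do — all statements below hold for ANY data
satisfying the normal form). [this file] -/
theorem lai_pf_exists_all (J r M : ℕ) (δ : Fin J → ℕ) (hJ1 : 1 ≤ J)
    (hdeg : ∀ n : ℕ, 1 + 2 * (r * n) + (∑ j, 2 * (δ j * n)) + 2 ≤ J * (M * n + 1)) :
    ∃ c : ℕ → ℕ → ℕ → ℚ, ∀ n : ℕ, ∀ t : ℚ, (∀ p : ℕ, p ≤ M * n → t + p + 1 ≠ 0) →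
      BallRivoal.pfEval (M * n) J (c n) t =
        ((laiPoly J r M n δ).comp (X + C 1)).eval t / BallRivoal.poch (t + 1) (M * n + 1) ^ J :=
  ⟨fun n => (lai_pf_exists J r M n δ hJ1 (hdeg n)).choose, fun n => (lai_pf_exists J r M n δ hJ1 (hdeg n)).choose_spec⟩

/-- Lai's coefficients `ρ̃_{n,s}/C_n` in the skeleton's indexing: `s = 0 ↦ −Σ_{o<J} Σ_k c_{o,k} H_k^{(o+1)}` (the rational
part), `1 ≤ s ≤ J ↦ Σ_k c_{s−1,k}` (the coefficient of `ζ(s)`; only odd `s ≥ 3` occur), `0` beyond `J`. [this file] -/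
def laiCoef (J M : ℕ) (c : ℕ → ℕ → ℕ → ℚ) (n s : ℕ) : ℚ :=
  if s = 0 then -∑ o ∈ range J, ∑ p ∈ range (M * n + 1), c n o p * harm (o + 1) p
  else if s ≤ J then ∑ p ∈ range (M * n + 1), c n (s - 1) p else 0

/-- **`hasSum` field**: `Σ_{k≥0} laiCore(k+1) = laiCoef n 0 + Σ_{3≤s≤J, s odd} laiCoef n s · ζ(s)`.
[cite: CressonFischlerRivoal2008, Théorème 1] -/
theorem laiCoef_hasSum (J r M : ℕ) (δ : Fin J → ℕ) (hJ : Even J) (hJ1 : 1 ≤ J) (hδ : ∀ j, 2 * δ j ≤ M)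
    (hdeg : ∀ n : ℕ, 1 + 2 * (r * n) + (∑ j, 2 * (δ j * n)) + 2 ≤ J * (M * n + 1))
    (c : ℕ → ℕ → ℕ → ℚ)
    (hc : ∀ n : ℕ, ∀ t : ℚ, (∀ p : ℕ, p ≤ M * n → t + p + 1 ≠ 0) →
      BallRivoal.pfEval (M * n) J (c n) t =
        ((laiPoly J r M n δ).comp (X + C 1)).eval t / BallRivoal.poch (t + 1) (M * n + 1) ^ J) (n : ℕ) :
    HasSum (fun k : ℕ => ((laiCore J r M n δ ((k : ℚ) + 1) : ℚ) : ℝ))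
      (((laiCoef J M c n 0 : ℚ) : ℝ) + ∑ s ∈ (Icc 3 J).filter Odd, ((laiCoef J M c n s : ℚ) : ℝ) * zetaValue s) := by
  convert laiCore_hasSum_pf J r M n δ hJ hJ1 hδ (hdeg n) (c n) (hc n) using 1
  have h0 : laiCoef J M c n 0 = -∑ o ∈ range J, ∑ p ∈ range (M * n + 1), c n o p * harm (o + 1) p := by
    simp [laiCoef]
  have hs : ∀ s ∈ (Icc 3 J).filter Odd, laiCoef J M c n s = ∑ p ∈ range (M * n + 1), c n (s - 1) p := by
    intro s hs
    have h1 := (mem_Icc.1 (mem_filter.1 hs).1)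
    simp [laiCoef, show s ≠ 0 by omega, h1.2]
  have hF : ∑ s ∈ (Icc 3 J).filter Odd, ((laiCoef J M c n s : ℚ) : ℝ) * zetaValue s =
      ∑ s ∈ (Icc 3 J).filter Odd, (∑ p ∈ range (M * n + 1), (c n (s - 1) p : ℝ)) * zetaValue s :=
    sum_congr rfl fun s hs' => by rw [hs s hs']; push_cast; ring
  rw [hF, h0]
  push_cast
  ring

/-- **`isInt` field (`Φ = 1`)**: `C_n · ∏_j D_{M_j n} · laiCoef n s ∈ ℤ` for all `n, s` (sorted `δ`, `dmin ≤ δ_j`,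
`2·dmin < M`). [this file] -/
theorem laiCoef_isInt (J r M : ℕ) (δ : Fin J → ℕ) (hδ : ∀ j, 2 * δ j ≤ M) (hM : 0 < M) (hmono : Monotone δ)
    (c : ℕ → ℕ → ℕ → ℚ)
    (hc : ∀ n : ℕ, ∀ t : ℚ, (∀ p : ℕ, p ≤ M * n → t + p + 1 ≠ 0) →
      BallRivoal.pfEval (M * n) J (c n) t =
        ((laiPoly J r M n δ).comp (X + C 1)).eval t / BallRivoal.poch (t + 1) (M * n + 1) ^ J)
    (dmin : ℕ) (hmin : ∀ j, dmin ≤ δ j) (h2 : 2 * dmin < M) (n s : ℕ) :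
    ∃ z : ℤ, (z : ℚ) = laiC J r M n δ * (∏ j, ((Nat.lcmUpto (max (M - 2 * dmin) (M - δ j) * n) : ℕ) : ℚ)) *
      laiCoef J M c n s := by
  rcases Nat.eq_zero_or_pos s with rfl | hs
  · obtain ⟨z, hz⟩ := lai_pf_harm_isInt J r M n δ hδ hM hmono (hc n) dmin hmin h2
    refine ⟨-z, ?_⟩
    simp only [laiCoef, if_true]
    push_cast
    rw [← hz]
    ring
  by_cases hsJ : s ≤ J
  · obtain ⟨z, hz⟩ := lai_pf_sum_isInt J r M n δ hδ hM (hc n) dmin hmin h2 hs hsJ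
    obtain ⟨w, hw⟩ := (pow_dvd_pow (Nat.lcmUpto ((M - 2 * dmin) * n)) (Nat.sub_le J s)).trans
      (lai_pow_dvd_blockDenom J M n δ dmin)
    refine ⟨w * z, ?_⟩
    have hcast : (∏ j, ((Nat.lcmUpto (max (M - 2 * dmin) (M - δ j) * n) : ℕ) : ℚ)) =
        ((∏ j, Nat.lcmUpto (max (M - 2 * dmin) (M - δ j) * n) : ℕ) : ℚ) := by push_cast; rfl
    simp only [laiCoef, show s ≠ 0 by omega, if_false, hsJ, if_true]
    rw [hcast, hw]
    push_cast
    rw [← hz]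
    ring
  · refine ⟨0, ?_⟩
    simp [laiCoef, show s ≠ 0 by omega, hsJ]

/-- **`dvd3` field (`Φ = 1`)**: for `3 ≤ s` and `J ≥ 3`, `C_n · ∏_j D_{M_j n} · laiCoef n s ∈ D_{(M−δ₂)n}^3 ℤ`
(0-indexed `δ₂`; Lai: `δ₀ = δ₁ = δ₂` gives `D_{(M−δ_min)n}^3`, the `γ₁ = 3(M−δ₁)` of [Lai2024BallRivoal, §13]). [this file] -/
theorem laiCoef_dvd3 (J r M : ℕ) (δ : Fin J → ℕ) (hδ : ∀ j, 2 * δ j ≤ M) (hM : 0 < M) (hmono : Monotone δ)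
    (hJ3 : 3 ≤ J) (c : ℕ → ℕ → ℕ → ℚ)
    (hc : ∀ n : ℕ, ∀ t : ℚ, (∀ p : ℕ, p ≤ M * n → t + p + 1 ≠ 0) →
      BallRivoal.pfEval (M * n) J (c n) t =
        ((laiPoly J r M n δ).comp (X + C 1)).eval t / BallRivoal.poch (t + 1) (M * n + 1) ^ J)
    (dmin : ℕ) (hmin : ∀ j, dmin ≤ δ j) (h2 : 2 * dmin < M) (n s : ℕ) (hs : 3 ≤ s) :
    ∃ z : ℤ, (z : ℚ) * ((Nat.lcmUpto ((M - δ ⟨2, by omega⟩) * n) ^ 3 : ℕ) : ℚ) =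
      laiC J r M n δ * (∏ j, ((Nat.lcmUpto (max (M - 2 * dmin) (M - δ j) * n) : ℕ) : ℚ)) * laiCoef J M c n s := by
  by_cases hsJ : s ≤ J
  · obtain ⟨z, hz⟩ := lai_pf_sum_isInt J r M n δ hδ hM (hc n) dmin hmin h2 (by omega) hsJ
    -- `E^3 · D^{J-3} ∣ ∏_j D_{M_j n}` and `D^{J-s} ∣ D^{J-3}`
    have h3 := lai_blockDenom_dvd J M n δ hmono dmin (o := 2) (by omega)
    obtain ⟨w, hw⟩ := (mul_dvd_mul_left (Nat.lcmUpto ((M - δ ⟨2, by omega⟩) * n) ^ (2 + 1))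
      (pow_dvd_pow (Nat.lcmUpto ((M - 2 * dmin) * n)) (show J - s ≤ J - (2 + 1) by omega))).trans h3
    refine ⟨w * z, ?_⟩
    have hcast : (∏ j, ((Nat.lcmUpto (max (M - 2 * dmin) (M - δ j) * n) : ℕ) : ℚ)) =
        ((∏ j, Nat.lcmUpto (max (M - 2 * dmin) (M - δ j) * n) : ℕ) : ℚ) := by push_cast; rfl
    simp only [laiCoef, show s ≠ 0 by omega, if_false, hsJ, if_true]
    rw [hcast, hw]
    push_cast
    rw [← hz]
    ring
  · refine ⟨0, ?_⟩
    simp [laiCoef, show s ≠ 0 by omega, hsJ]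

end Denominators

end Summit.KontsevichZagierPeriods.Zeta5Search

end
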